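import Mathlib
import Summits.ValiantsHypothesis.ValiantsHypothesis.Theorems.GrenetZeonPolySizeQPAlgebraNilpotentIdeal
import HarnessLib

/-!
# Crux `GrenetZeon.PolySizeQPAlgebra` (stmt-ValiantsHypothesis-8064), line `vbp-slice-dealg` —
# every coefficient algebra: the local Hessian bound OUTSIDE the window `3 ≤ q ≤ ν` of residual coranks

`…NilpotentIdeal` shows the Hessian of `λ(det A)` vanishes at residual corank `q ≥ ν + 2` when `𝔪^ν = 0`.
One corank lower, `q = ν + 1`, the terms `T₁…T₄` still vanish (`adj S ∈ 𝔪^ν = 0`) and the second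
polarisation has coefficients in `𝔪^{ν-1}`, which kills `𝔪`: it depends on the perturbation only through
RESIDUES, so its read-out has rank `≤ q²` — and `q² ≤ 2·dim R·n` since `q ≤ n` and `ν + 1 ≤ 2 dim R`.
Together with residual corank `≤ 2` (`…ResidualCorankTwo`) this settles the type-independent bound at
every point whose residual corank lies outside `3 ≤ q ≤ ν`:

* `det_updateRow_eq_of_residue_eq_pow` — residue replacement in a row when `ν - 1` other rows lie in `𝔪`.
* `rank_secondPolar_readOut_le_sq_of_pow` — second-polarisation read-out for `S ∈ Mat_q(𝔪)`, `q ≥ ν+1`,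
  `q ≥ 3`: rank `≤ q²`.
* `rank_hess0_transl_le_sq_of_pow_normalForm` — at normal forms of corank `q ≥ ν + 1`: `rank Hess ≤ q²`.
* `rank_hess0_transl_le_outside_window` — **for every finite-dimensional commutative `ℂ`-algebra `R` with
  a character `φ`, `(ker φ)^ν = 0`, `ν + 1 ≤ 2 dim R` (automatic for the nilpotency index), every `λ`, every
  affine `n × n` matrix `A`, every point `p` with `det A(p) = 0` in `R` and a residually maximal minor of size
  `k` with `n ≤ k + 2` or `n ≥ k + ν + 1`: `rank Hess λ(det A)(p) ≤ 2 · dim_ℂ R · n`.**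

So per local type the input `LocalHessianBound₃` (`…LocalReductionResidualThree`) has content ONLY at
residual coranks `3 ≤ q ≤ ν(R)`: none for square-zero types (recovering `…SquareZeroResidue`), exactly
`q = 3` for `𝔪³ = 0` (e.g. `ℂ[x,y]/(x²,y²)`, the residual type of the rung `(n,4)`), `q ∈ {3,4}` for
`𝔪⁴ = 0`, … .  HONEST FRAMING: rank theorems; no stub of the line is closed; VP ≠ VNP is not moved.

References: T. Mignon, N. Ressayre, IMRN 2004:79, §2 [MignonRessayre2004].
-/

noncomputable section

open MvPolynomial Matrix
open Literature.Computability.AlgebraicComplexity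

-- single-conjunct layout `Summits/ValiantsHypothesis/ValiantsHypothesis`: duplicated namespace by design
set_option linter.dupNamespace false

namespace Summit.ValiantsHypothesis.ValiantsHypothesis.Theorems.GrenetZeonPolySizeQPAlgebra

section PowResidue

variable {R : Type*} [CommRing R] [Algebra ℂ R] {m : Type*} [Fintype m] [DecidableEq m]

/-- **Residue replacement in a row, nilpotent version.**  If `(ker φ)^ν = 0`, at least `ν - 1` rows of
`M` other than `q` lie in `ker φ`, and `x, x'` have the same residues, then replacing row `q` by `x` or
by `x'` gives the same determinant. [folklore] -/
theorem det_updateRow_eq_of_residue_eq_pow (φ : R →ₐ[ℂ] ℂ) {ν : ℕ}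
    (hker : RingHom.ker (φ : R →+* ℂ) ^ ν = ⊥) (M : Matrix m m R) (q : m) (T : Finset m)
    (hqT : q ∉ T) (hT : ν ≤ T.card + 1) (hrows : ∀ r ∈ T, ∀ j, φ (M r j) = 0) (x x' : m → R)
    (hx : ∀ j, φ (x j) = φ (x' j)) : (M.updateRow q x).det = (M.updateRow q x').det := by
  classical
  have hsplit : x = x' + (x - x') := by abel
  rw [hsplit, Matrix.det_updateRow_add, add_eq_left]
  refine det_eq_zero_of_rows_mem_pow (RingHom.ker (φ : R →+* ℂ)) hker _ (insert q T) ?_ ?_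
  · rw [Finset.card_insert_of_notMem hqT]; omega
  · intro r hr j
    rcases Finset.mem_insert.1 hr with rfl | hrT
    · rw [Matrix.updateRow_self, RingHom.mem_ker, Pi.sub_apply, AlgHom.coe_toRingHom, map_sub, hx j,
        sub_self]
    · rw [Matrix.updateRow_ne (ne_of_mem_of_not_mem hrT hqT), RingHom.mem_ker]
      exact hrows r hrT j

variable {σ : Type*} [Fintype σ]

/-- **Residue form of the second-polarisation read-out at residual corank `≥ ν + 1`.**  If
`(ker φ)^ν = 0` and `S ∈ Mat_m(ker φ)` with `|m| ≥ ν + 1` and `|m| ≥ 3`, then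
`(s,t) ↦ λ(Σ_r Σ_{q≠r} det(S | row r ← (Y_t)_r, row q ← (X_s)_q))` depends on `X_s` only through `φ(X_s)`,
hence has rank `≤ |m|²`. [folklore] -/
theorem rank_secondPolar_readOut_le_sq_of_pow (φ : R →ₐ[ℂ] ℂ) {ν : ℕ}
    (hker : RingHom.ker (φ : R →+* ℂ) ^ ν = ⊥) (l : R →ₗ[ℂ] ℂ) (S : Matrix m m R)
    (hS : ∀ i j, φ (S i j) = 0) (hm : ν + 1 ≤ Fintype.card m) (hm3 : 3 ≤ Fintype.card m)
    (Xf Yf : σ → Matrix m m R) :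
    (Matrix.of fun s t => l (∑ r, ∑ q, if q = r then 0 else
        ((S.updateRow r (Yf t r)).updateRow q (Xf s q)).det)).rank ≤
      Fintype.card m * Fintype.card m := by
  classical
  set c : ℂ → R := fun z => algebraMap ℂ R z with hc
  have hres : ∀ (r q : m), q ≠ r → ∀ (y x : m → R),
      ((S.updateRow r y).updateRow q x).det = ((S.updateRow r y).updateRow q (fun j => c (φ (x j)))).det := by
    intro r q hqr y x
    refine det_updateRow_eq_of_residue_eq_pow φ hker _ q ((Finset.univ.erase r).erase q)
      (fun h => (Finset.mem_erase.1 h).1 rfl) ?_ (fun r' hr' j => ?_) _ _ (fun j => ?_)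
    · have h1 : (Finset.univ.erase r).card = Fintype.card m - 1 := by
        rw [Finset.card_erase_of_mem (Finset.mem_univ r), Finset.card_univ]
      have h3 : ((Finset.univ.erase r).erase q).card ≥ (Finset.univ.erase r).card - 1 :=
        Finset.pred_card_le_card_erase
      omega
    · rw [Matrix.updateRow_ne (Finset.mem_erase.1 (Finset.mem_erase.1 hr').2).1]; exact hS _ _
    · rw [hc, AlgHom.commutes, Algebra.algebraMap_self, RingHom.id_apply]
  have hadd : ∀ (t : σ) (M N : Matrix m m ℂ),
      (∑ r, ∑ q, if q = r then (0 : R) else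
        ((S.updateRow r (Yf t r)).updateRow q (fun j => c ((M + N) q j))).det) =
      (∑ r, ∑ q, if q = r then (0 : R) else
        ((S.updateRow r (Yf t r)).updateRow q (fun j => c (M q j))).det) +
      ∑ r, ∑ q, if q = r then (0 : R) else
        ((S.updateRow r (Yf t r)).updateRow q (fun j => c (N q j))).det := by
    intro t M N
    rw [← Finset.sum_add_distrib]
    refine Finset.sum_congr rfl fun r _ => ?_
    rw [← Finset.sum_add_distrib]
    refine Finset.sum_congr rfl fun q _ => ?_
    split_ifs with h
    · rw [add_zero]
    · rw [show (fun j => c ((M + N) q j)) = (fun j => c (M q j)) + fun j => c (N q j) by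
        funext j; simp [hc, Matrix.add_apply], Matrix.det_updateRow_add]
  have hsmul : ∀ (t : σ) (a : ℂ) (M : Matrix m m ℂ),
      (∑ r, ∑ q, if q = r then (0 : R) else
        ((S.updateRow r (Yf t r)).updateRow q (fun j => c ((a • M) q j))).det) =
      c a * ∑ r, ∑ q, if q = r then (0 : R) else
        ((S.updateRow r (Yf t r)).updateRow q (fun j => c (M q j))).det := by
    intro t a M
    rw [Finset.mul_sum]
    refine Finset.sum_congr rfl fun r _ => ?_
    rw [Finset.mul_sum]
    refine Finset.sum_congr rfl fun q _ => ?_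
    split_ifs with h
    · rw [mul_zero]
    · rw [show (fun j => c ((a • M) q j)) = c a • fun j => c (M q j) by
        funext j; simp [hc, Matrix.smul_apply], Matrix.det_updateRow_smul]
  let ψ : σ → (Matrix m m ℂ →ₗ[ℂ] ℂ) := fun t =>
    { toFun := fun M => l (∑ r, ∑ q, if q = r then 0 else
        ((S.updateRow r (Yf t r)).updateRow q (fun j => c (M q j))).det)
      map_add' := fun M N => by rw [hadd, map_add]
      map_smul' := fun a M => by rw [hsmul, hc, ← Algebra.smul_def, map_smul, RingHom.id_apply] }
  have h : (Matrix.of fun s t => l (∑ r, ∑ q, if q = r then 0 else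
      ((S.updateRow r (Yf t r)).updateRow q (Xf s q)).det)) =
      Matrix.of fun s t => ψ t ((Xf s).map φ) := by
    ext s t
    simp only [Matrix.of_apply]
    change _ = l _
    congr 1
    refine Finset.sum_congr rfl fun r _ => Finset.sum_congr rfl fun q _ => ?_
    split_ifs with hqr
    · rfl
    · rw [hres r q hqr]
      rfl
  rw [h]
  refine (rank_linear_readOut_le (fun s => (Xf s).map φ) ψ).trans ?_
  rw [Module.finrank_matrix ℂ ℂ m m, Module.finrank_self, mul_one]

variable [DecidableEq σ] {κ : Type*} [Fintype κ] [DecidableEq κ]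

/-- **Normal form of residual corank `q ≥ ν + 1` (`(ker φ)^ν = 0`): `rank Hess ≤ q²`.**  At
`A(p) = diag(1_κ, S)`, `S ∈ Mat_m(ker φ)`, `|m| ≥ ν + 1`, `|m| ≥ 3`: `adj S = 0 = det S` and the second
polarisation factors through residues, so `rank Hess λ(det A)(p) ≤ |m|²`. [cite: MignonRessayre2004, §2] -/
theorem rank_hess0_transl_le_sq_of_pow_normalForm (φ : R →ₐ[ℂ] ℂ) {ν : ℕ}
    (hker : RingHom.ker (φ : R →+* ℂ) ^ ν = ⊥) (l : R →ₗ[ℂ] ℂ)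
    (A : Matrix (κ ⊕ m) (κ ⊕ m) (MvPolynomial σ R)) (F : MvPolynomial σ ℂ)
    (hA : ∀ a b, (A a b).totalDegree ≤ 1) (hF : ∀ d, l (coeff d A.det) = coeff d F)
    (p : σ → ℂ) (S : Matrix m m R)
    (hB : A.map (eval fun i => algebraMap ℂ R (p i)) = Matrix.fromBlocks 1 0 0 S)
    (hS : ∀ i j, φ (S i j) = 0) (hm : ν + 1 ≤ Fintype.card m) (hm3 : 3 ≤ Fintype.card m) :
    (hess0 (transl p F)).rank ≤ Fintype.card m * Fintype.card m := by
  classical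
  have hS' : ∀ i j, S i j ∈ RingHom.ker (φ : R →+* ℂ) := fun i j => by simpa using hS i j
  set x : σ → R := fun i => algebraMap ℂ R (p i) with hx
  set Xf : σ → Matrix m m R := fun s => (A.map fun a => eval x (pderiv s a)).toBlocks₂₂ with hXf
  have hH : hess0 (transl p F) = Matrix.of fun s t => l (∑ r, ∑ q, if q = r then 0 else
      ((S.updateRow r (Xf t r)).updateRow q (Xf s q)).det) := by
    ext s t
    rw [hess0_transl_readOut l hF p s t,
      eval_pderiv_pderiv_det_blockNormalForm_general x s t A hA S hB _ _ rfl rfl,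
      adjugate_eq_zero_of_mem_pow _ hker S hS' hm, det_eq_zero_of_mem_pow _ hker S hS' (by omega),
      Matrix.of_apply]
    simp only [Matrix.zero_mul, Matrix.trace_zero, mul_zero, add_zero, zero_add, hXf]
  rw [hH]
  exact rank_secondPolar_readOut_le_sq_of_pow φ hker l S hS hm hm3 Xf Xf

end PowResidue

/-! ### Every coefficient algebra: the bound at all residual coranks `≥ ν + 1` and `≤ 2` -/

section Assembly

variable {σ : Type*} [Fintype σ] [DecidableEq σ] {R : Type*} [CommRing R] [Algebra ℂ R] [Module.Finite ℂ R]

/-- **`LocalHessianBound` outside the window `3 ≤ q ≤ ν`.**  Let `R` be a finite-dimensional commutative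
`ℂ`-algebra with a character `φ`, `(ker φ)^ν = 0` and `ν + 1 ≤ 2 · dim_ℂ R` (true for the nilpotency index,
which is `≤ dim R`); `λ` any functional, `A` an affine `n × n` matrix with read-out `F = λ(det A)`, `p` a
point with `det A(p) = 0` in `R` whose residual corank `q` (co-size of a residually maximal minor) satisfies
`q ≤ 2` or `q ≥ ν + 1`.  Then `rank Hess F(p) ≤ 2 · dim_ℂ R · n`.  Equivalently: the input
`LocalHessianBound₃` carries content only at residual coranks `3 ≤ q ≤ ν` — none for square-zero types
(`ν = 2`), only `q = 3` for `𝔪³ = 0` (e.g. `ℂ[x,y]/(x²,y²)`). [cite: MignonRessayre2004, §2] -/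
theorem rank_hess0_transl_le_outside_window {n : ℕ} (φ : R →ₐ[ℂ] ℂ) {ν : ℕ}
    (hker : RingHom.ker (φ : R →+* ℂ) ^ ν = ⊥) (hν : ν + 1 ≤ 2 * Module.finrank ℂ R) (l : R →ₗ[ℂ] ℂ)
    (A : Matrix (Fin n) (Fin n) (MvPolynomial σ R)) (F : MvPolynomial σ ℂ)
    (hA : ∀ a b, (A a b).totalDegree ≤ 1) (hF : ∀ d, l (coeff d A.det) = coeff d F) (p : σ → ℂ)
    (hp : eval (fun i => algebraMap ℂ R (p i)) A.det = 0) {k : ℕ} (r c : Fin k → Fin n)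
    (hu : φ ((A.map (eval fun i => algebraMap ℂ R (p i))).submatrix r c).det ≠ 0)
    (hmax : ∀ a b : Fin n, φ ((A.map (eval fun i => algebraMap ℂ R (p i))).submatrix
      (Sum.elim r fun _ : Unit => a) (Sum.elim c fun _ : Unit => b)).det = 0)
    (hq : n ≤ k + 2 ∨ k + ν + 1 ≤ n) :
    (hess0 (transl p F)).rank ≤ 2 * Module.finrank ℂ R * n := by
  classical
  haveI : Nontrivial R := RingHom.domain_nontrivial (φ : R →+* ℂ)
  set B : Matrix (Fin n) (Fin n) R := A.map (eval fun i => algebraMap ℂ R (p i)) with hB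
  have hr : Function.Injective r := by
    intro i j hij
    by_contra hne
    apply hu
    rw [Matrix.det_zero_of_row_eq hne (funext fun l => by simp only [Matrix.submatrix_apply, hij]),
      map_zero]
  have hkn : k ≤ n := by simpa using Fintype.card_le_of_injective r hr
  -- tiny sizes first
  rcases Nat.lt_or_ge n 2 with hn | hn
  · interval_cases n
    · exfalso
      rw [Matrix.det_isEmpty, map_one] at hp
      exact one_ne_zero hp
    · have hB1 : (A.map (eval fun i => algebraMap ℂ R (p i))).det = 0 := by
        rw [← RingHom.mapMatrix_apply, ← RingHom.map_det, hp]
      have hmv : Matrix.mulVec (A.map (eval fun i => algebraMap ℂ R (p i))) (fun _ => (1 : R)) = 0 := by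
        ext i
        fin_cases i
        rw [Matrix.det_fin_one, Matrix.map_apply] at hB1
        simp [Matrix.mulVec, dotProduct, hB1]
      simpa using rank_hess0_transl_le_of_mulVec_eq_zero l A F hA hF p (fun _ => (1 : R)) hmv
        ⟨0, isUnit_one⟩
  -- residual corank `≤ 2`: descend to a unit `(n-2)`-minor
  by_cases hk2 : n ≤ k + 2
  · obtain ⟨d, hd⟩ : ∃ d, k = (n - 2) + d := ⟨k - (n - 2), by omega⟩
    subst hd
    obtain ⟨r', c', h'⟩ := exists_residual_minor_sub (φ : R →+* ℂ) B (n - 2) d r c hu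
    have h := rank_hess0_transl_le_of_residual_minor_ne_zero φ hker l A F hA hF p hp r' c' h'
      (by simp only [Fintype.card_fin]; omega)
    simpa only [Fintype.card_fin] using h
  -- residual corank `q ≥ 3` and, by `hq`, `q ≥ ν + 1`
  have hkν : k + ν + 1 ≤ n := by omega
  obtain ⟨q, hqn⟩ : ∃ q, n = k + q := ⟨n - k, by omega⟩
  rcases Nat.lt_or_ge q (ν + 2) with hq1 | hq2
  · have h := rank_hess0_transl_le_of_maximal_minor (m := Fin q) φ hker l A F hA hF p r c hu hmax
      (by simp only [Fintype.card_fin]; omega)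
      fun l' A' S hA' hF' hB' hS' =>
        rank_hess0_transl_le_sq_of_pow_normalForm φ hker l' A' F hA' hF' p S hB' hS'
          (by simp only [Fintype.card_fin]; omega) (by simp only [Fintype.card_fin]; omega)
    simp only [Fintype.card_fin] at h
    have hqq : q * q ≤ 2 * Module.finrank ℂ R * n := by
      calc q * q ≤ 2 * Module.finrank ℂ R * q := Nat.mul_le_mul_right q (by omega)
        _ ≤ 2 * Module.finrank ℂ R * n := Nat.mul_le_mul_left _ (by omega)
    omega
  · have h := hess0_transl_rank_eq_zero_of_pow_point (m := Fin q) φ hker l A F hA hF p r c hu hmax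
      (by simp only [Fintype.card_fin]; omega) (by simpa only [Fintype.card_fin] using hq2)
    rw [h]
    exact Nat.zero_le _

end Assembly

end Summit.ValiantsHypothesis.ValiantsHypothesis.Theorems.GrenetZeonPolySizeQPAlgebra

end
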